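import Summits.ResolutionOfSingularities.ResolutionOfSingularities.Theorems.FrobeniusLadderFInjectiveMacaulayficationTauFloorInputNotFull
import Summits.ResolutionOfSingularities.ResolutionOfSingularities.Theorems.FrobeniusLadderFInjectiveMacaulayficationTauFloorP2d4F5RowTwo
import Summits.ResolutionOfSingularities.ResolutionOfSingularities.Theorems.FrobeniusLadderFInjectiveMacaulayficationTauFloorP2d4BLegal
import Summits.ResolutionOfSingularities.ResolutionOfSingularities.Theorems.FrobeniusLadderFInjectiveMacaulayficationLx6q7PointFloorRow
import Summits.ResolutionOfSingularities.ResolutionOfSingularities.Theorems.FrobeniusLadderFInjectiveMacaulayficationLx6c5PointFloorRow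
import Summits.ResolutionOfSingularities.ResolutionOfSingularities.Theorems.FrobeniusLadderFInjectiveMacaulayficationTauFloorP2d5CInput
import Summits.ResolutionOfSingularities.ResolutionOfSingularities.Theorems.FrobeniusLadderFInjectiveMacaulayficationLx6q7d5PointFloorRow
import Summits.ResolutionOfSingularities.ResolutionOfSingularities.Theorems.FrobeniusLadderFInjectiveMacaulayficationFDTwoStoreyRow
import Summits.ResolutionOfSingularities.ResolutionOfSingularities.Theorems.FrobeniusLadderFInjectiveMacaulayficationP3d4z4557PointFloorRow
import Summits.ResolutionOfSingularities.ResolutionOfSingularities.Theorems.FrobeniusLadderFInjectiveMacaulayficationLx3p3PointFloorRow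
import Summits.ResolutionOfSingularities.ResolutionOfSingularities.Theorems.FrobeniusLadderFInjectiveMacaulayficationB9PointFloorRowClass
import Summits.ResolutionOfSingularities.ResolutionOfSingularities.Theorems.FrobeniusLadderFInjectiveMacaulayficationSigma5P2d4CPointFloorRowClass
import Summits.ResolutionOfSingularities.ResolutionOfSingularities.Theorems.FrobeniusLadderFInjectiveMacaulayficationSigma3P2d4F5PointFloorRowClass
import Summits.ResolutionOfSingularities.ResolutionOfSingularities.Theorems.FrobeniusLadderFInjectiveMacaulayficationLx3p3ShiftPointFloorRowClass
import Summits.ResolutionOfSingularities.ResolutionOfSingularities.Theorems.FrobeniusLadderFInjectiveMacaulayficationP3d4z4557PointFloorRowClass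
import Summits.ResolutionOfSingularities.ResolutionOfSingularities.Theorems.FrobeniusLadderFInjectiveMacaulayficationTCaFloorOneRow
import Summits.ResolutionOfSingularities.ResolutionOfSingularities.Theorems.FrobeniusLadderFInjectiveMacaulayficationP2d4CChar2Germ
import Summits.ResolutionOfSingularities.ResolutionOfSingularities.Theorems.FrobeniusLadderFInjectiveMacaulayficationP2d4BChar2Germ
import Summits.ResolutionOfSingularities.ResolutionOfSingularities.Theorems.FrobeniusLadderFInjectiveMacaulayficationP2d4F5Char2Germ
import Summits.ResolutionOfSingularities.ResolutionOfSingularities.Theorems.FrobeniusLadderFInjectiveMacaulayficationX2Cubic4FloorFull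
import Summits.ResolutionOfSingularities.ResolutionOfSingularities.Theorems.FrobeniusLadderFInjectiveMacaulayficationHypersurfaceOriginNotFull
import Summits.ResolutionOfSingularities.ResolutionOfSingularities.Theorems.FrobeniusLadderFInjectiveMacaulayficationT4GermChar7
import Summits.ResolutionOfSingularities.ResolutionOfSingularities.Theorems.FrobeniusLadderFInjectiveMacaulayficationX2CyclicCubicChar3
import Summits.ResolutionOfSingularities.ResolutionOfSingularities.Theorems.FrobeniusLadderFInjectiveMacaulayficationX2QuarticFSideChar3
import Summits.ResolutionOfSingularities.ResolutionOfSingularities.Theorems.FrobeniusLadderFInjectiveMacaulayficationDiagonalSqRowOfF108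
import Summits.ResolutionOfSingularities.ResolutionOfSingularities.Theorems.FrobeniusLadderFInjectiveMacaulayficationBrieskornPhamMultiChart
import Summits.ResolutionOfSingularities.ResolutionOfSingularities.Theorems.FrobeniusLadderFInjectiveMacaulayficationAutMonomialFloorCured
import Summits.ResolutionOfSingularities.ResolutionOfSingularities.Theorems.FrobeniusLadderFInjectiveMacaulayficationFloorCuredOfClassModel
import Summits.ResolutionOfSingularities.ResolutionOfSingularities.Theorems.FrobeniusLadderFInjectiveMacaulayficationFHalfRowOfNewtonNondegenerateFree
import Summits.ResolutionOfSingularities.ResolutionOfSingularities.Theorems.FInjectiveMacaulayfication.Negative.NonFullTowerConjecture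
import Summits.ResolutionOfSingularities.ResolutionOfSingularities.Theorems.FrobeniusLadderFInjectiveMacaulayficationF108ClassRowUnconditional
import Summits.ResolutionOfSingularities.ResolutionOfSingularities.Theorems.FrobeniusLadderFInjectiveMacaulayficationF108Unconditional
import Summits.ResolutionOfSingularities.ResolutionOfSingularities.Theorems.FrobeniusLadderFInjectiveMacaulayficationSigma3P2d4BPointFloorRowClass
import Summits.ResolutionOfSingularities.ResolutionOfSingularities.Theorems.FrobeniusLadderFInjectiveMacaulayficationSigma7Lx6c3PointFloorRowClass
import Summits.ResolutionOfSingularities.ResolutionOfSingularities.Theorems.FrobeniusLadderFInjectiveMacaulayficationPencilFedder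
import Summits.ResolutionOfSingularities.ResolutionOfSingularities.Theorems.FrobeniusLadderFInjectiveMacaulayficationF108ConsumableRelHolds
import Summits.ResolutionOfSingularities.ResolutionOfSingularities.Theorems.FrobeniusLadderFInjectiveMacaulayficationMonomialFloorUnconditional
import Summits.ResolutionOfSingularities.ResolutionOfSingularities.Theorems.FrobeniusLadderFInjectiveMacaulayficationSigma7Lx6q7PointFloorRowUncond
import Summits.ResolutionOfSingularities.ResolutionOfSingularities.Theorems.FrobeniusLadderFInjectiveMacaulayficationSigma7Lx6c5PointFloorRowUncond
import Summits.ResolutionOfSingularities.ResolutionOfSingularities.Theorems.FrobeniusLadderFInjectiveMacaulayficationSigma7Lx6c5PointFloorRowClass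
import Summits.ResolutionOfSingularities.ResolutionOfSingularities.Theorems.FrobeniusLadderFInjectiveMacaulayficationSigma5P2d5CPointFloorRowClass
import Summits.ResolutionOfSingularities.ResolutionOfSingularities.Theorems.FrobeniusLadderFInjectiveMacaulayficationSigma7Lx6q7d5PointFloorRowUncond
import HarnessLib

/-!
# THE F-SIDE REGISTRAR OF CHAIN w45a: one module, uniform names, one letter shape each — (i) the two-sided kernel rows of the F-half census, (ii) the class-route cross-certificates,
# (iii) the germ-currency instances `¬ FullCl p (𝒪_{X,v}) ∧ FInjectivizationGermAt p v`, (iv) the class theorems with their standing hypotheses, (v) the negative theorem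
# (crux `FInjectiveMacaulayfication` stmt-ResolutionOfSingularities-15315; res-L1-w45a-plan-1 queue 01:27Z (3) «THE F-SIDE REGISTRAR `…FCensusRegistrar.lean` (imports + alias theorems only,
# no new mathematics) … the object next generations and the editions cite instead of 40 file names; lead-1 keeps the T-side registrar»; seat res-L1-w45a-stub-1 g14)

[OURS · L1 W4.5a] Support file (`--supports stmt-ResolutionOfSingularities-15315 --as helper`); def-free; NO NEW MATHEMATICS — every entry is an `alias` of an accepted theorem (the p-id and the
owning seat are in its docstring); §6 collects germ pairs into two conjunctions. Standing hypotheses are repeated per entry: `CharP k p` for the stated `p`; `k = k̄` (`IsAlgClosed`) where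
the class route is used; CONDITIONAL entries carry the named OURS interface (`F108Consumable` / `F108ConsumableRel`, `@[conjecture]` definitions — NOT Literature facts) as an explicit
binder. Nothing of the crux `FInjectiveMacaulayfication` is proved by any entry; every row is a certificate on ONE bed (or one explicit family); AI-written (AI review is weaker than
expert review).

LETTER SHAPES. «ROW» = for every blowing up `g : S′ → Spec 𝒪_{X,v}` along the stated floor: (LEGAL: centre `≠ ⊥`, supported in the non-regular locus, `S′` regular off the closed fibre,
CM everywhere) ∧ (NOT FULL: some stalk over the closed point is not `FullCl p`) ∧ (CURED: `∃ 𝓚 ≠ ⊥` on `S′` supported over the closed point, every blowing up of `S′` along `𝓚` FULL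
everywhere). «GERM» = `¬ FullCl p (𝒪_{X,v}) ∧ GermForm.FInjectivizationGermAt p v`. «FLOOR-FULL ROW» = LEGAL ∧ every blowing up along the floor FULL everywhere (the floor itself is the cure).
* §1 rows #1–#7 (p = 2; τ-floors and point floors of the (4,2)/(5,2) beds), #8 (BED D, two storeys), (4,3) BED W / BED T, #9 (B9, every `p ∤ 18`), #1ᵖᵗ/#2ᵖᵗ (point floors via the
  class route), TCa (floor-1-FULL).
* §2 cross-certificates (the class route re-proving a row: P2d4C∘σ₅, P2d4F5∘σ₃, BED T shift, BED W twin; BED W conditional via the Brieskorn–Pham five-floor theorem).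
* §3 germ instances (P2d4C, P2d4B, P2d4F5, BED D, TCa, B9, Fermat/double-point cubic at p = 2, cyclic cubic at p = 2, Fermat quartic at p = 3, x² + Σ cubes for p ∉ {2,3}, T⁽⁴⁾/7).
* §4 class theorems: data versions (tame / weak), the conditional one-name theorems (point floor; Brieskorn–Pham two-floor and five-floor; diagonal; monomial floors; transported monomial
  floors; cure by domination), and the UNCONDITIONAL simplest-kind class rows (p = 2 smooth cubics, p = 3 quartics).
* §5 the negative theorem `¬ NonFullTowerConjecture` (our own memoryless recipe, refuted in the kernel).
* §6 `germPairs_char2`, `germPairs_char3` — conjunctions of germ pairs (the only non-alias declarations).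
-/

-- single-problem summit: the doubled namespace component is forced
set_option linter.dupNamespace false

noncomputable section

namespace Summit.ResolutionOfSingularities.ResolutionOfSingularities.Theorems.FInjectiveMacaulayfication.FCensusRegistrar

open CategoryTheory CategoryTheory.Limits AlgebraicGeometry TopologicalSpace IsLocalRing MvPolynomial
open Literature.AlgebraicGeometry.Resolution
open Summit.ResolutionOfSingularities.ResolutionOfSingularities.Theorems.FInjectiveMacaulayfication
open SliceableCentre GermForm

/-! ## §1 The two-sided kernel rows -/

/-- **F-ROW #1** — bed P2d4C `z² + x⁴z + y³ + u³ + t³`, `p = 2`, τ-FLOOR (test-ideal centre), any field of characteristic 2: ROW. (res-L1-w45a-stub-3, ✓p624800.) [OURS · alias] -/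
alias row01_P2d4C_tauFloor := TauFloorInputNotFull.f4pos_row_one

/-- **F-ROW #2** — bed P2d4F5, `p = 2`, τ-floor: ROW. (res-L1-w45a-stub-2/stub-3, ✓p635437.) [OURS · alias] -/
alias row02_P2d4F5_tauFloor := TauFloorP2d4F5RowTwo.f4pos_row_two

/-- **F-ROW #3** — bed P2d4B, `p = 2`, τ-floor: ROW. (✓p637863.) [OURS · alias] -/
alias row03_P2d4B_tauFloor := TauFloorP2d4BLegal.f4pos_row_three

/-- **F-ROW #4** — bed d4lx6q7 `z² + x⁶z + y³ + u³ + t⁷`, `p = 2`, POINT floor (the TauTower refuting floor): ROW. (✓p647707.) [OURS · alias] -/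
alias row04_Lx6q7_pointFloor := Lx6q7PointFloorRow.f4pos_row_four

/-- **F-ROW #5** — bed d4lx6c5, `p = 2`, point floor: ROW. (✓p650217.) [OURS · alias] -/
alias row05_Lx6c5_pointFloor := Lx6c5PointFloorRow.f4pos_row_five

/-- **F-ROW #6** — the (5,2) bed P2d5C, `p = 2`, τ-floor: ROW (first `d = 5` row). (✓p642216.) [OURS · alias] -/
alias row06_P2d5C_tauFloor := TauFloorP2d5CInput.f5pos_row_one

/-- **F-ROW #7** — the (5,2) bed d5lx6q7, `p = 2`, point floor: ROW. (res-L1-w45a-stub-2, ✓p658464.) [OURS · alias] -/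
alias row07_Lx6q7d5_pointFloor := Lx6q7d5PointFloorRow.f5pos_row_two

/-- **F-ROW #8** — BED D `z⁴ + x⁵z + x⁶ + y³ + u³ + t⁷`, `p = 2`, point floor, cured in TWO STOREYS (local second storey at the one bad point): ROW. (res-L1-w45a-stub-1 g13, ✓p677691.) [OURS · alias] -/
alias row08_BEDD_pointFloor_twoStorey := FDTwoStoreyRow.f4pos_rowD_twoStorey

/-- **F-ROW (4,3) #1** — BED W `z³ + x⁴ + y⁵ + u⁵ + t⁷`, `p = 3`, point floor (by cells): ROW. (res-L1-w45a-stub-2, ✓p660468.) [OURS · alias] -/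
alias rowW_P3d4z4557_pointFloor := P3d4z4557PointFloorRow.f4pos_row_p3_one

/-- **F-ROW (4,3) #2** — BED T `z² + x⁴z + y⁴ + u⁴ + t⁵`, `p = 3`, point floor: ROW. (res-L1-w45a-stub-3, ✓p674181.) [OURS · alias] -/
alias rowT_Lx3p3_pointFloor := Lx3p3PointFloorRow.f4pos_p3_rowT

/-- **F-ROW #9** — B9 `z² + x⁹ + y⁹ + u⁹ + t⁹`, EVERY prime `p ∤ 18`, `k = k̄`, point floor (class route, 25-cone Newton fan): ROW. (res-L1-w45a-stub-3 g12, ✓p681294.) [OURS · alias] -/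
alias row09_B9_pointFloor_allP := B9PointFloorRowClass.f4pos_rowB9

/-- **F-ROW #1ᵖᵗ** — P2d4C, `p = 2`, `k = k̄`, POINT floor (class route through `σ₅`, transported back): ROW. (res-L1-w45a-stub-2 g11, ✓p681805.) [OURS · alias] -/
alias row1pt_P2d4C_pointFloor_class := Sigma5P2d4CPointFloorRowClass.pointFloorRow_P2d4C_class

/-- **F-ROW #2ᵖᵗ** — P2d4F5, `p = 2`, `k = k̄`, point floor (class route through `σ₃`): ROW. (res-L1-w45a-stub-2 g11, ✓p686526.) [OURS · alias] -/
alias row2pt_P2d4F5_pointFloor_class := Sigma3P2d4F5PointFloorRowClass.pointFloorRow_P2d4F5_class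

/-- **TCa FLOOR-1-FULL ROW, legality half** — bed TCa `z⁴ + x²y² + x⁵ + y⁵ + u⁵ + t⁵`, `p = 2`: the point floor is a LEGAL input. (res-L1-w45a-stub-1 g12, ✓p662224.) [OURS · alias] -/
alias rowTCa_pointFloor_legal := TCaFloorOneRow.pointFloor_tca_input_legal

/-- **TCa FLOOR-1-FULL ROW, FULL half** — every blowing up along TCa's point floor is FULL at every stalk (the floor is the cure). (✓p662224.) [OURS · alias] -/
alias rowTCa_pointFloor_full := TCaFloorOneRow.pointFloor_tca_full

/-! ## §2 Cross-certificates of the class route -/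

/-- **X-CERT P2d4C** — the σ₅-retro-fit pilot: the class row for `σ₅(f_{P2d4C})`, `k = k̄`, char 2. (res-L1-w45a-stub-2 g11, ✓p681805.) [OURS · alias] -/
alias xcert_P2d4C_sigma5_class := Sigma5P2d4CPointFloorRowClass.f4pos_row_sigma5_class

/-- **X-CERT P2d4F5** — the class row for `σ₃(f_{P2d4F5})`, `k = k̄`, char 2. (✓p686526.) [OURS · alias] -/
alias xcert_P2d4F5_sigma3_class := Sigma3P2d4F5PointFloorRowClass.f4pos_row_sigma3F5_class

/-- **X-CERT BED T** — BED T's point-floor row re-proved through the class route (shift `z ↦ z + 2x⁴`), `k = k̄`, char 3. (res-L1-w45a-stub-2 g11, ✓p685260.) [OURS · alias] -/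
alias xcert_BEDT_class := Lx3p3ShiftPointFloorRowClass.pointFloorRow_bedT_class

/-- **X-CERT BED W** — BED W's point-floor row re-proved through the class route (Newton-fan twin), `k = k̄`, char 3. (res-L1-w45a-stub-3 g12.) [OURS · alias] -/
alias xcert_BEDW_class := P3d4z4557PointFloorRowClass.f4pos_row_p3_one_class

/-- **X-CERT BED W, CONDITIONAL** — BED W as a member of the Brieskorn–Pham five-floor conditional row (`F108Consumable k 5`, `k = k̄`, char 3; exponent vector (7,5,5,4), swap `x ↔ t`).
(res-L1-w45a-stub-1 g14, ✓p683828.) [OURS · alias; CONDITIONAL] -/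
alias xcert_BEDW_conditional_brieskornPham := BrieskornPhamMultiChart.bedW_row_of_F108Consumable

/-! ## §3 Germ-currency instances `¬ FullCl p ∧ FInjectivizationGermAt p v` -/

/-- **GERM P2d4C** (`p = 2`, any field): `¬ FullCl 2 (𝒪_{X,v}) ∧ FInjectivizationGermAt 2 v`. (res-L1-w45a-stub-2, ✓p610550.) [OURS · alias] -/
alias germ_P2d4C := P2d4CChar2Germ.p2d4c_bad_germ_row

/-- **GERM P2d4B** (`p = 2`). (✓p613365.) [OURS · alias] -/
alias germ_P2d4B := P2d4BChar2Germ.p2d4b_bad_germ_row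

/-- **GERM P2d4F5** (`p = 2`). (✓p612829.) [OURS · alias] -/
alias germ_P2d4F5 := P2d4F5Char2Germ.p2d4f5_bad_germ_row

/-- **GERM BED D** (`p = 2`; two storeys): `FInjectivizationGermAt 2 v`. (res-L1-w45a-stub-1 g13, ✓p677691.) [OURS · alias] -/
alias germ_BEDD := FDTwoStoreyRow.fD_fInjectivizationGermAt

/-- **GERM TCa** (`p = 2`; the point floor cures): `FInjectivizationGermAt 2 v`. (✓p662224.) [OURS · alias] -/
alias germ_TCa := TCaFloorOneRow.tca_fInjectivizationGermAt

/-- **GERM B9** (every `p ∤ 18`, `k = k̄`): `FInjectivizationGermAt p v`. (res-L1-w45a-stub-3, ✓p685054.) [OURS · alias] -/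
alias germ_B9_allP := B9PointFloorRowClass.b9_fInjectivizationGermAt_of_not_dvd

/-- **GERM x² + y³ + u³ + t³ + s³** (every `p ∉ {2,3}`; the point floor is FULL — a floor-1-full germ, T-side bed): `FInjectivizationGermAt p v`. (res-L1-w45a-lead-1, ✓ `X2Cubic4FloorFull`.)
[OURS · alias] -/
alias germ_X2Cubic4_pNot23 := X2Cubic4FloorFull.x2cubic4_fInjectivizationGermAt_charP

/-- **GERM double point `X₀² + ΣX_{l+1}³`, char 2** (any number of cubes `≥ 3`): the full germ package incl. `FInjectivizationGermAt 2 v`. (res-L1-w45a-stub-1 g9.) [OURS · alias] -/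
alias germ_doublePointFermatCubic_char2 := HypersurfaceOriginNotFull.doublePoint_vertex_bad_germ_instance

/-- **GERM Fermat cubic cone `ΣX_l³`, char 2**. (res-L1-w45a-stub-1 g9.) [OURS · alias] -/
alias germ_fermatCubicCone_char2 := HypersurfaceOriginNotFull.fermatCubicCone_vertex_bad_germ_instance

/-- **GERM x² + Fermat cubic form, `p = 2`** (class-route letter `X₄² + rename F`): GERM. (res-L1-w45a-stub-1 g14, ✓p684337.) [OURS · alias] -/
alias germ_X2FermatCubicForm_char2 := X2CubicFormFSideChar2.fermat_bad_germ_row_char2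

/-- **GERM x² + cyclic cubic `Y₀²Y₁+Y₁²Y₂+Y₂²Y₃+Y₃²Y₀`, `p = 2`**: GERM. (res-L1-w45a-stub-1 g14, ✓p684896.) [OURS · alias] -/
alias germ_X2CyclicCubic_char2 := X2CyclicCubicChar2.cyclic_bad_germ_row_char2

/-- **GERM Fermat quartic `z² + x⁴ + y⁴ + u⁴ + t⁴`, `p = 3`** (any field of characteristic 3; the point floor — a NON-NORMAL FULL pinch floor — is the cure): GERM.
(res-L1-w45a-stub-1 g14, `X2QuarticFSideChar3`.) [OURS · alias] -/
alias germ_FermatQuartic_char3 := X2QuarticFSideChar3.fermatQuartic_bad_germ_row_char3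

/-- **GERM T⁽⁴⁾/7** (`p = 7`, the bed of ✓p601374): the germ package at the origin. (res-L1-w45a-stub-1 g9.) [OURS · alias] -/
alias germ_T4_char7 := T4GermChar7.t4_origin_germ_instance

/-! ## §4 Class theorems (with their standing hypotheses) -/

/-- **CLASS (data, tame)** — `k = k̄`, char `p`, any `n`: `f` prime Newton NON-DEGENERATE + `x̄ᵢ ≠ 0` + regular off `v` + explicit fan/cover tables (hunit-free form) ⇒ point floor CURED.
UNCONDITIONAL in its tables. (res-L1-w45a-stub-1 g12, ✓p653810.) [OURS · alias] -/
alias class_pointFloorCured_of_newtonNondegenerate_tables := FHalfRowOfNewtonNondegenerate.fHalfRow_of_newtonNondegenerate'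

/-- **CLASS (data, weak)** — as above with WEAKLY (Tjurina) non-degenerate `f`; UNCONDITIONAL in its tables. (res-L1-w45a-stub-1/stub-3, ✓p656605.) [OURS · alias] -/
alias class_pointFloorCured_of_weaklyNondegenerate_tables := FHalfRowOfNewtonNondegenerate.fHalfRow_of_weaklyNondegenerate

/-- **CLASS (conditional, point floor)** — CONDITIONAL on `F108ClassRow.F108Consumable k n`; `k = k̄`, char `p`: prime, convenient, weakly non-degenerate, `x̄ᵢ ≠ 0`, regular off `v`,
+ elementary per-bed chart/Fedder data ⇒ ROW for the point floor. (res-L1-w45a-stub-1 g13, ✓p680734.) [OURS · alias; CONDITIONAL] -/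
alias class_pointFloorRow_of_F108Consumable := F108ClassRow.pointFloorRow_of_F108Consumable

/-- **CLASS (conditional, point floor, CURED half only)**. (✓p680734.) [OURS · alias; CONDITIONAL] -/
alias class_pointFloorCured_of_F108Consumable := F108ClassRow.fHalfRow_of_F108Consumable

/-- **CLASS (conditional, along coordinate changes fixing the origin)**. (✓p680734.) [OURS · alias; CONDITIONAL] -/
alias class_pointFloorRow_of_F108Consumable_of_ringEquiv := F108ClassRow.pointFloorRow_of_F108Consumable_of_ringEquiv

/-- **CLASS (conditional) — the DIAGONAL double-point family `z² + Σx_j^a`**, `a` odd `≥ 5`, `2, a ≠ 0` in `k`, `k = k̄`: ROW. (res-L1-w45a-stub-1 g13, ✓p681601.) [OURS · alias; CONDITIONAL] -/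
alias class_diagonalRow_of_F108Consumable := DiagonalSqRowOfF108.diagonalRow_of_F108Consumable

/-- **CLASS (conditional) — the diagonal family at EVERY `p` incl. `p = 2`** (no `2 ≠ 0`, no `Odd a`; `a ≥ 5`, `a ≠ 0` in `k`). (res-L1-w45a-stub-1 g14, ✓p683460.) [OURS · alias; CONDITIONAL] -/
alias class_diagonalRow_of_F108Consumable_allP := BrieskornPhamRowOfF108.diagonalRow_of_F108Consumable'

/-- **CLASS (conditional) — the BRIESKORN–PHAM family `z^c + x^{a₀} + y^{a₁} + u^{a₂} + t^{a₃}`**, `2 ≤ c < a₀ ≤ a_j`, `a_j ≠ 0` in `k` (c FREE mod p), floor inequality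
`⌊(p−1)/c⌋ + ⌊(p−1)/(a₀−c)⌋ < p−1`, `k = k̄`: ROW. (res-L1-w45a-stub-1 g14, ✓p683460.) [OURS · alias; CONDITIONAL] -/
alias class_brieskornPhamRow_of_F108Consumable := BrieskornPhamRowOfF108.brieskornPhamRow_of_F108Consumable

/-- **CLASS (conditional) — Brieskorn–Pham, FIVE-FLOOR form (no ordering of the exponents)**. (✓p683828.) [OURS · alias; CONDITIONAL] -/
alias class_brieskornPhamRow_of_F108Consumable_fiveFloor := BrieskornPhamMultiChart.brieskornPhamRow_of_F108Consumable_of_fiveFloor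

/-- **UNCONDITIONAL input side of the Brieskorn–Pham family**: the point floor is NOT FULL under the floor inequality, every prime `p` (any field with a primality witness).
(✓p683460.) [OURS · alias] -/
alias input_brieskornPham_pointFloor_not_full := BrieskornPhamRowOfF108.pointFloor_bp_not_full

/-- **CLASS (data, monomial floor)** — `(x̄^A) = (x̄^B)·(x̄^KA)` tables ⇒ the MONOMIAL floor `(x^B)` is CURED; UNCONDITIONAL in its tables. (res-L1-w45a-stub-1 g14, ✓p685336.) [OURS · alias] -/
alias class_monomialFloorCured_tables := MonomialFloorClassRow.fHalfRowRel_of_tables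

/-- **CLASS (conditional, monomial floors)** — CONDITIONAL on `MonomialFloorClassRow.F108ConsumableRel k n`: every `𝔪`-primary MONOMIAL floor of a convenient-WND bed is CURED
(`k = k̄`, char `p`). (✓p685336.) [OURS · alias; CONDITIONAL] -/
alias class_monomialFloorCured_of_F108ConsumableRel := MonomialFloorClassRow.monomialFloorCured_of_F108ConsumableRel

/-- The two interfaces are ordered: `F108ConsumableRel k n → F108Consumable k n`. (✓p685336.) [OURS · alias] -/
alias interface_f108Consumable_of_rel := MonomialFloorClassRow.f108Consumable_of_rel

/-- **CLASS (conditional, transported monomial floors)** — a floor that is `𝔪`-primary MONOMIAL under an origin-fixing automorphism `φ` with `φ f` convenient-WND is CURED;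
CONDITIONAL on `F108ConsumableRel`. (res-L1-w45a-stub-1 g14, ✓p686042.) [OURS · alias; CONDITIONAL] -/
alias class_autMonomialFloorCured_of_F108ConsumableRel := AutMonomialFloorCured.autMonomialFloorCured_of_F108ConsumableRel

/-- **GLUE — cure by domination**: `Bl_{I·(L·J)}` FULL everywhere ⇒ the floor `I` is CURED (any domain; `v ⊆ √L`, `v ⊆ √J`). UNCONDITIONAL glue. (res-L1-w45a-stub-1 g14, ✓p686952.) [OURS · alias] -/
alias glue_floorCured_of_fullBlowup_classModel := FloorCuredOfClassModel.floorCured_of_fullBlowup_classModel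

/-- **UNCONDITIONAL CLASS ROW, p = 2** — `x² + F₃`, `F₃ ∈ (Yᵢ²)` a cubic form with smooth prime dehomogenisations, `f` prime, isolated (any field of characteristic 2): vertex NOT F-pure and the
point floor is LEGAL and FULL at every stalk (one-storey cure). (res-L1-w45a-stub-1 g14, ✓p684337, over res-L1-w45a-lead-1's ✓p682339.) [OURS · alias] -/
alias class_fSideRow_smoothCubic_char2 := X2CubicFormFSideChar2.fSide_classRow_smoothCubic_char2

/-- **UNCONDITIONAL CLASS ROW, p = 3** — `x² + F₄`, `F₄ ∈ (Yᵢ³)` a quartic form with pointwise-smooth dehomogenisations, `f` prime, isolated (any field of characteristic 3): vertex NOT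
F-pure and the (non-normal, pinch) point floor is LEGAL and FULL at every stalk. (res-L1-w45a-stub-1 g14, `X2QuarticFSideChar3`, over lead-1's ✓p683974.) [OURS · alias] -/
alias class_fSideRow_quartic_char3 := X2QuarticFSideChar3.fSide_classRow_quartic_char3

/-- **FLOOR FULLness for `x² + F₄`, every ODD `p`** (smooth dehomogenisations): `Bl_𝔪 Y` FULL at every point. (res-L1-w45a-stub-1 g14, ✓p686758.) [OURS · alias] -/
alias floor_affineBlowup_fullCl_quartic_oddP := X2QuarticPointFloor.affineBlowup_fullCl_quartic

/-! ## §5 The negative theorem -/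

/-- **NEG-A** — `¬ Recipes.NonFullTowerConjecture`: our own memoryless `N_red`-tower recipe dies in the kernel (admissible point floor of `z² + x⁶z + y³ + u³ + t³` at (4,2) over `𝔽₂`),
HYPOTHESIS-FREE. (texts res-L1-w45a-tri-2, filer res-L1-w45a-stub-1 g12, ✓p649617.) [OURS · alias] -/
alias neg_not_nonFullTowerConjecture := Negative.NonFullTowerConjecture.not_nonFullTowerConjecture

/-! ## §6 Germ pairs collected -/

/-- **The `p = 2` germ pairs of the registrar, collected** (any field `k` of characteristic 2): P2d4C, the Fermat-cubic double point (class letter), the cyclic-cubic double point — each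
`¬ FullCl 2 (𝒪_{X,v}) ∧ FInjectivizationGermAt 2 v` at the origin. [OURS · bookkeeping conjunction of accepted theorems] -/
theorem germPairs_char2 (k : Type) [Field k] [CharP k 2] :
    (∀ (f : MvPolynomial (Fin 5) k), f = X 4 ^ 2 + X 0 ^ 4 * X 4 + X 1 ^ 3 + X 2 ^ 3 + X 3 ^ 3 →
      ∀ (v : Spec (.of (MvPolynomial (Fin 5) k ⧸ Ideal.span {f}))), v.asIdeal = Ideal.span (Set.range fun j : Fin 5 => Ideal.Quotient.mk (Ideal.span {f}) (X j)) →
        ¬ FullCl 2 ((Spec (.of (MvPolynomial (Fin 5) k ⧸ Ideal.span {f}))).presheaf.stalk v) ∧ FInjectivizationGermAt 2 v) ∧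
    (∀ (f : MvPolynomial (Fin 5) k), f = X 4 ^ 2 + rename (Fin.castSucc : Fin 4 → Fin 5) (X 0 ^ 3 + X 1 ^ 3 + X 2 ^ 3 + X 3 ^ 3 : MvPolynomial (Fin 4) k) →
      ∀ (v : Spec (.of (MvPolynomial (Fin 5) k ⧸ Ideal.span {f}))), v.asIdeal = Ideal.span (Set.range fun j : Fin 5 => Ideal.Quotient.mk (Ideal.span {f}) (X j)) →
        ¬ FullCl 2 ((Spec (.of (MvPolynomial (Fin 5) k ⧸ Ideal.span {f}))).presheaf.stalk v) ∧ FInjectivizationGermAt 2 v) ∧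
    (∀ (f : MvPolynomial (Fin 5) k), f = X 4 ^ 2 + rename (Fin.castSucc : Fin 4 → Fin 5) (X 0 ^ 2 * X 1 + X 1 ^ 2 * X 2 + X 2 ^ 2 * X 3 + X 3 ^ 2 * X 0 : MvPolynomial (Fin 4) k) →
      ∀ (v : Spec (.of (MvPolynomial (Fin 5) k ⧸ Ideal.span {f}))), v.asIdeal = Ideal.span (Set.range fun j : Fin 5 => Ideal.Quotient.mk (Ideal.span {f}) (X j)) →
        ¬ FullCl 2 ((Spec (.of (MvPolynomial (Fin 5) k ⧸ Ideal.span {f}))).presheaf.stalk v) ∧ FInjectivizationGermAt 2 v) :=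
  ⟨fun f hf v hv => P2d4CChar2Germ.p2d4c_bad_germ_row k f hf v hv, fun f hf v hv => X2CubicFormFSideChar2.fermat_bad_germ_row_char2 k f hf v hv,
    fun f hf v hv => X2CyclicCubicChar2.cyclic_bad_germ_row_char2 k f hf v hv⟩

/-- **The `p = 3` germ pair of the registrar** (any field of characteristic 3): the Fermat quartic `z² + x⁴ + y⁴ + u⁴ + t⁴` — `¬ FullCl 3 (𝒪_{X,v}) ∧ FInjectivizationGermAt 3 v`.
[OURS · bookkeeping] -/
theorem germPairs_char3 (k : Type) [Field k] [CharP k 3] :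
    ∀ (f : MvPolynomial (Fin 5) k), f = X 4 ^ 2 + rename (Fin.castSucc : Fin 4 → Fin 5) (X 0 ^ 4 + X 1 ^ 4 + X 2 ^ 4 + X 3 ^ 4 : MvPolynomial (Fin 4) k) →
      ∀ (v : Spec (.of (MvPolynomial (Fin 5) k ⧸ Ideal.span {f}))), v.asIdeal = Ideal.span (Set.range fun j : Fin 5 => Ideal.Quotient.mk (Ideal.span {f}) (X j)) →
        ¬ FullCl 3 ((Spec (.of (MvPolynomial (Fin 5) k ⧸ Ideal.span {f}))).presheaf.stalk v) ∧ FInjectivizationGermAt 3 v :=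
  fun f hf v hv => X2QuarticFSideChar3.fermatQuartic_bad_germ_row_char3 k f hf v hv

/-! ## §7 Registrar v2 (2026-08-29 ≈02:25Z): the UNCONDITIONAL class column, rows #3ᵖᵗ and #10, the BED Ω engine -/

/-- **UNCONDITIONAL CLASS (point floor CURED)** — res-L1-toric-fan's ✓p687854 `F108Consumable_holds` composed: `k = k̄`, any `p`, any `n`; `f` prime convenient WND, `x̄ᵢ ≠ 0`, regular off
`v` ⇒ point floor CURED. (res-L1-toric-fan, ✓p688090.) [OURS · alias; UNCONDITIONAL] -/
alias uncond_pointFloorCured_convenientWND := F108ClassRow.fHalfRow_of_convenient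

/-- **UNCONDITIONAL CLASS (two-sided letter)** from the elementary per-bed data. (✓p688090.) [OURS · alias; UNCONDITIONAL] -/
alias uncond_pointFloorRow_convenientWND := F108ClassRow.pointFloorRow_of_convenient

/-- **UNCONDITIONAL CLASS along origin-fixing automorphisms**. (✓p688090.) [OURS · alias; UNCONDITIONAL] -/
alias uncond_pointFloorRow_convenientWND_of_ringEquiv := F108ClassRow.pointFloorRow_of_convenient_of_ringEquiv

/-- **UNCONDITIONAL GERM FORM** `FInjectivizationGermAt p v` for every bed of the class. (res-L1-w45a-stub-1 g14, ✓p689071.) [OURS · alias; UNCONDITIONAL] -/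
alias uncond_germ_convenientWND := F108Unconditional.fInjectivizationGermAt_convenientWND

/-- **UNCONDITIONAL Brieskorn–Pham row** (two-floor form, `a₀` minimal; every `c ≥ 2`, every admissible `p`). (✓p689071.) [OURS · alias; UNCONDITIONAL] -/
alias uncond_brieskornPhamRow := F108Unconditional.brieskornPhamRow

/-- **UNCONDITIONAL Brieskorn–Pham row, five-floor form**. (✓p689071.) [OURS · alias; UNCONDITIONAL] -/
alias uncond_brieskornPhamRow_fiveFloor := F108Unconditional.brieskornPhamRow_fiveFloor

/-- **UNCONDITIONAL diagonal family at every `p`** (`z² + Σx_j^a`, `a ≥ 5`, `a ≠ 0` in `k`). (✓p689071.) [OURS · alias; UNCONDITIONAL] -/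
alias uncond_diagonalRow_allP := F108Unconditional.diagonalRow_allP

/-- **UNCONDITIONAL BED W through the class route** (`k = k̄`, char 3). (✓p689071.) [OURS · alias; UNCONDITIONAL] -/
alias uncond_bedW_row_classRoute := F108Unconditional.bedW_row_classRoute

/-- **F-ROW #3ᵖᵗ** — P2d4B, `p = 2`, `k = k̄`, POINT floor (class route through `σ₃`): ROW. (res-L1-w45a-stub-2 g11, ✓p687780.) [OURS · alias] -/
alias row3pt_P2d4B_pointFloor_class := Sigma3P2d4BPointFloorRowClass.pointFloorRow_P2d4B_class

/-- **GERM P2d4B through the class route** (`k = k̄`, `p = 2`). (✓p687780.) [OURS · alias] -/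
alias germ_P2d4B_class := Sigma3P2d4BPointFloorRowClass.p2d4b_fInjectivizationGermAt_class

/-- **F-ROW #10** — the NEG bed d4lx6c3 `z² + x⁶z + y³ + u³ + t³` (where the `N_red` recipe was refuted, ✓p649617), `p = 2`, `k = k̄`, POINT floor through the class route (`σ₇`): ROW —
«recipe dead, class route alive on the same bed». (res-L1-w45a-stub-2 g11, ✓p688187.) [OURS · alias] -/
alias row10_Lx6c3_pointFloor_class := Sigma7Lx6c3PointFloorRowClass.pointFloorRow_Lx6c3_class

/-- **GERM d4lx6c3 through the class route**. (✓p688187.) [OURS · alias] -/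
alias germ_Lx6c3_class := Sigma7Lx6c3PointFloorRowClass.lx6c3_fInjectivizationGermAt_class

/-- **ENGINE (BED Ω)** — (†)'s NON-FULL direction: `M^jB^{p−1−j} ∈ J ∀ j ⇒ (M·w − B)^{p−1} ∈ J` for every `w`. (res-L1-w45a-stub-1 g14, `PencilFedder`.) [OURS · alias] -/
alias engine_pencil_pow_mem := PencilFedder.pencil_pow_mem

/-- **ENGINE (BED Ω)** — the pencil chart `{M·W = B}` is NOT FULL at the fibre point `(Q, w₀)`, every `w₀`. (`PencilFedder`.) [OURS · alias] -/
alias engine_pencilChart_not_full_at := PencilFedder.pencilChart_not_full_at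

/-- **ENGINE (BED Ω)** — the CM clause of the pencil chart as a codimension-2 complete intersection over a class-model chart. (`PencilFedder`.) [OURS · alias] -/
alias engine_pencilChart_cmCl := PencilFedder.pencilChart_cmCl

/-- **Registrar v2 index theorem**: the unconditional germ form and the `p = 3` Fermat-quartic germ pair, side by side (both kernel theorems; bookkeeping conjunction). [OURS · bookkeeping] -/
theorem germs_v2 (k : Type) [Field k] [CharP k 3] [IsAlgClosed k] :
    (∀ (f : MvPolynomial (Fin 5) k), f = X 4 ^ 2 + rename (Fin.castSucc : Fin 4 → Fin 5) (X 0 ^ 4 + X 1 ^ 4 + X 2 ^ 4 + X 3 ^ 4 : MvPolynomial (Fin 4) k) →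
      ∀ (v : Spec (.of (MvPolynomial (Fin 5) k ⧸ Ideal.span {f}))), v.asIdeal = Ideal.span (Set.range fun j : Fin 5 => Ideal.Quotient.mk (Ideal.span {f}) (X j)) →
        FInjectivizationGermAt 3 v) ∧
    (∀ (a : ℕ), 5 ≤ a → ((a : ℕ) : k) ≠ 0 → ∀ (f : MvPolynomial (Fin 5) k), f = X 4 ^ 2 + X 0 ^ a + X 1 ^ a + X 2 ^ a + X 3 ^ a →
      ∀ (v : Spec (.of (MvPolynomial (Fin 5) k ⧸ Ideal.span {f}))), v.asIdeal = Ideal.span (Set.range fun j : Fin 5 => Ideal.Quotient.mk (Ideal.span {f}) (X j)) →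
        ∀ (S' : Scheme.{0}) (g : S' ⟶ Spec ((Spec (.of (MvPolynomial (Fin 5) k ⧸ Ideal.span {f}))).presheaf.stalk v)),
          IsBlowup g ((affineBlowup.idealSheaf (Ideal.span (Set.range (fun j : Fin 5 => Ideal.Quotient.mk (Ideal.span {f}) (X j))))).comap
            ((Spec (.of (MvPolynomial (Fin 5) k ⧸ Ideal.span {f}))).fromSpecStalk v)) →
          ∃ s : S', g.base s = closedPoint _ ∧ ¬ FullCl 3 (S'.presheaf.stalk s)) := by
  haveI : Fact (Nat.Prime 3) := ⟨Nat.prime_three⟩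
  exact ⟨fun f hf v hv => (X2QuarticFSideChar3.fermatQuartic_bad_germ_row_char3 k f hf v hv).2,
    fun a ha5 haK f hf v hv S' g hg => (F108Unconditional.diagonalRow_allP k 3 a ha5 haK f hf v hv S' g hg).2.1⟩

/-! ## §8 Registrar v3 (2026-08-29 ≈03:00Z, RULINGS R22.32–R22.34): the interface `F108ConsumableRel` DISCHARGED, the monomial-floor column unconditional, thin rows #4ᵖᵗ–#7ᵖᵗ, xcert #4 -/

/-- **INTERFACE DISCHARGED** — `MonomialFloorClassRow.F108ConsumableRel k n` holds for every field `k` and every `n` (res-L1-toric-fan g2 ✓p690554 + ✓p690109: one run of the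
edge-star engine on the sum set `supp f + B`, shifted state, sumset tables). [OURS · alias] -/
alias interface_F108ConsumableRel_holds := MonomialFloorClassRow.F108ConsumableRel_holds
/-- **UNCONDITIONAL MONOMIAL-FLOOR CURE** — every `𝔪`-primary monomial floor of a prime convenient weakly-non-degenerate isolated hypersurface germ over `k̄` (any `p`, any `n ≥ 1`) is
cured. (`MonomialFloorUnconditional` ✓p691017, on ✓p690554.) [OURS · alias] -/
alias uncond_monomialFloorCured := MonomialFloorUnconditional.monomialFloorCured
/-- **UNCONDITIONAL MONOMIAL-FLOOR CURE, Brieskorn–Pham beds** (✓p691017). [OURS · alias] -/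
alias uncond_brieskornPham_monomialFloorCured := MonomialFloorUnconditional.brieskornPham_monomialFloorCured
/-- **UNCONDITIONAL CURE OF TRANSPORTED MONOMIAL FLOORS** `φ⁻¹(x^B)`, `φ` origin-fixing with `φ f` in the class (✓p691017, on ✓p686042 + ✓p690554). [OURS · alias] -/
alias uncond_autMonomialFloorCured := MonomialFloorUnconditional.autMonomialFloorCured
/-- **ROW #4ᵖᵗ** — the `lx6q7` bed (`z² + x⁶z + x¹³ + x¹⁴ + y³ + u³ + w⁷`, `p = 2`) at the POINT floor: LEGAL ∧ NOT FULL ∧ CURED, thin row on ✓p688090 (stub-3 ✓p689857). [OURS · alias] -/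
alias row4pt_lx6q7_pointFloor_uncond := Sigma7Lx6q7PointFloorRowUncond.pointFloorRow_lx6q7_uncond
/-- **GERM lx6q7, point floor** (✓p689857). [OURS · alias] -/
alias germ_lx6q7_uncond := Sigma7Lx6q7PointFloorRowUncond.lx6q7_fInjectivizationGermAt_uncond
/-- **ROW #5ᵖᵗ** — the `lx6c5` bed (`… + w⁵`, `p = 2`) at the POINT floor, thin row on ✓p688090 (stub-3 ✓p689936). [OURS · alias] -/
alias row5pt_lx6c5_pointFloor_uncond := Sigma7Lx6c5PointFloorRowUncond.pointFloorRow_lx6c5_uncond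
/-- **GERM lx6c5, point floor, thin route** (✓p689936). [OURS · alias] -/
alias germ_lx6c5_uncond := Sigma7Lx6c5PointFloorRowUncond.lx6c5_fInjectivizationGermAt_uncond
/-- **CROSS-CERTIFICATE #4** — the SAME row #5ᵖᵗ by the INDEPENDENT explicit data route (387-chart fan `Σ_f′ ∧ Σ(𝔪)`, kit j322136, tables ✓p687247 + cover records + ✓p688368 checks +
✓p689048 fan; stub-3 ✓p689431): two kernel routes, one statement (compare `row5pt_lx6c5_pointFloor_uncond`). [OURS · alias] -/
alias xcert4_lx6c5_pointFloor_class := Sigma7Lx6c5PointFloorRowClass.pointFloorRow_lx6c5_class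
/-- **GERM lx6c5, point floor, data route** (✓p689431). [OURS · alias] -/
alias germ_lx6c5_class := Sigma7Lx6c5PointFloorRowClass.lx6c5_fInjectivizationGermAt_class
/-- **ROW #6ᵖᵗ** — the `(5,2)` bed `P2d5C` (`n = 6`, 71-chart fan, `p = 2`) at the POINT floor, class route (stub-2 ✓p688935): the first dimension-5 point-floor row. [OURS · alias] -/
alias row6pt_P2d5C_pointFloor_class := Sigma5P2d5CPointFloorRowClass.pointFloorRow_P2d5C_class
/-- **GERM P2d5C, point floor** (✓p688935). [OURS · alias] -/
alias germ_P2d5C_class := Sigma5P2d5CPointFloorRowClass.p2d5c_fInjectivizationGermAt_class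
/-- **ROW #7ᵖᵗ** — the `Lx6q7d5` bed (`n = 6`, `p = 2`) at the POINT floor: the FIRST THIN ROW (one term on ✓p688090 `…_of_ringEquiv` + a translate, no tables; stub-2 ✓p689604). [OURS · alias] -/
alias row7pt_Lx6q7d5_pointFloor_uncond := Sigma7Lx6q7d5PointFloorRowUncond.pointFloorRow_Lx6q7d5_uncond
/-- **GERM Lx6q7d5, point floor** (✓p689604). [OURS · alias] -/
alias germ_Lx6q7d5_uncond := Sigma7Lx6q7d5PointFloorRowUncond.lx6q7d5_fInjectivizationGermAt_uncond

/-- **Registrar v3 index theorem**: the interface `F108ConsumableRel` holds in every dimension over every field, and with it the point interface `F108Consumable` (✓p685336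
`f108Consumable_of_rel`) — bookkeeping conjunction of two kernel theorems. [OURS · bookkeeping] -/
theorem interfaces_v3 (k : Type) [Field k] (n : ℕ) : MonomialFloorClassRow.F108ConsumableRel k n ∧ F108ClassRow.F108Consumable k n :=
  ⟨MonomialFloorClassRow.F108ConsumableRel_holds k n, MonomialFloorClassRow.f108Consumable_of_rel k (MonomialFloorClassRow.F108ConsumableRel_holds k n)⟩

end Summit.ResolutionOfSingularities.ResolutionOfSingularities.Theorems.FInjectiveMacaulayfication.FCensusRegistrar

end
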